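import Summits.ABC.IUTFork.Joshi.FrobenioidsJoshi
import HarnessLib

/-!
# Joshi, *Arithmetic Teichmüller spaces III* Prop. 10.3.3 (1) SHARPENED: two Frobenioid structures `Frob(E,|−|₁)`, `Frob(E,|−|₂)` on one
# field are abstractly isomorphic (compatibly with `x ↦ x mod O^*`) IF AND ONLY IF the absolute values are equivalent — proof-only
# companion of `Joshi/FrobenioidsJoshi.lean`

Record file of the abc-iut cell, branch E (rung LADDER-ABC:A2.E; seat abc-iut-E-t32; a DERIVABLE row on this seat's own `Joshi/FrobenioidsJoshi.lean`
(p430621), [J-III] = arXiv:2401.13508 **v4** §10.3, p.131 l.41 – p.132 l.23; bib `Joshi2024ATS3`; UNREFEREED and disputed [Mochizuki2024JoshiReport];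
typed ≠ proved ≠ endorsed; no side taken; no Cor. 3.12 vocabulary, E-PLAN R14).

WHAT IS PROVED. `Frob.prop1033_1_of_isEquiv` (p430621) derived Prop. 10.3.3 (1) «the two Frobenioid structures on `E` … are abstractly isomorphic» from
Joshi's proof sentence «`E` and `ι(E)` are isomorphic as valued fields» read as EQUIVALENCE of the two absolute values (Mathlib `AbsoluteValue.IsEquiv`).
Here the CONVERSE: an isomorphism `Frob.FrobIso v₁ v₂` (divisor groups `|E^*|₁ ≃ |E^*|₂` compatible with `x ↦ x mod O^*` and carrying `Φ₁ = |O^▹|₁` onto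
`Φ₂`) forces `{|x|₁ ≤ 1} = {|x|₂ ≤ 1}`, i.e. equal valuation rings, i.e. equivalent absolute values (`Frob.isEquiv_of_frobIso`); hence
`Frob.Prop1033_1 v₁ v₂ ↔ v₁.IsEquiv v₂` (`Frob.prop1033_1_iff_isEquiv`). So, in Joshi's elementary-Frobenioid vocabulary, «abstractly isomorphic
Frobenioid structures on `E`» says exactly «the same valuation ring», and by (2) the arithmetic degrees then differ by the exponent `c` of
`|−|₂ = |−|₁^c` — the dilatation of [ATS I] (seat E-t1's `UntiltPoints.IsDilatation`). A LOCATION of where the rescaling lives, not an adjudication.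
[claim: Joshi2024ATS3, status: disputed]
-/

noncomputable section

namespace Summit.ABC.IUTFork.Joshi.ATS3.Frob

variable {E : Type} [Field E] {v₁ v₂ : AbsoluteValue E ℝ}

/-- An isomorphism of the two Frobenioid structures identifies the valuation rings: `|x|₁ ≤ 1 ↔ |x|₂ ≤ 1` for `x ∈ E^*` (the divisor monoid
`Φ = O^▹/O^*` is carried onto the divisor monoid, compatibly with `x ↦ x mod O^*`). [folklore] -/
theorem FrobIso.le_one_iff (e : FrobIso v₁ v₂) (x : Eˣ) : v₁ (x : E) ≤ 1 ↔ v₂ (x : E) ≤ 1 := by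
  rw [← mem_intMonoid, ← mem_intMonoid, ← prin_mem_divMonoid_iff, ← prin_mem_divMonoid_iff, ← e.map_prin]
  exact (e.map_div (prin v₁ x)).symm

/-- **Converse of Prop. 10.3.3 (1)**: abstractly isomorphic Frobenioid structures on `E` (in the sense of `Frob.FrobIso`) come from EQUIVALENT
absolute values. [folklore] -/
theorem isEquiv_of_frobIso (e : FrobIso v₁ v₂) : v₁.IsEquiv v₂ := by
  refine AbsoluteValue.isEquiv_iff_lt_one_iff.2 fun x => ?_
  rcases eq_or_ne x 0 with rfl | hx
  · simp
  have h1 : 0 < v₁ x := v₁.pos hx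
  have h2 : 0 < v₂ x := v₂.pos hx
  have hinv := e.le_one_iff (Units.mk0 x hx)⁻¹
  simp only [Units.val_inv_eq_inv_val, Units.val_mk0, map_inv₀, inv_le_one₀ h1, inv_le_one₀ h2] at hinv
  constructor
  · intro h; by_contra h'; exact absurd (hinv.2 (not_lt.1 h')) (not_le.2 h)
  · intro h; by_contra h'; exact absurd (hinv.1 (not_lt.1 h')) (not_le.2 h)

/-- **Prop. 10.3.3 (1) as an EQUIVALENCE**: `Frob(E,|−|₁) ≅ Frob(E,|−|₂)` abstractly (`Frob.Prop1033_1`) iff `|−|₁`, `|−|₂` are equivalent — with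
p430621's `prop1033_1_of_isEquiv` for the forward construction. [folklore] -/
theorem prop1033_1_iff_isEquiv : Prop1033_1 v₁ v₂ ↔ v₁.IsEquiv v₂ :=
  ⟨fun ⟨e⟩ => isEquiv_of_frobIso e, prop1033_1_of_isEquiv⟩

/-- Consequently an abstract isomorphism that IS degree-compatible forces EQUAL absolute values on every `x ∈ E^*` — the contrapositive reading of
Prop. 10.3.3 (2) (p430621's `prop1033_2_of_ne`). [folklore] -/
theorem apply_eq_of_degCompatible (e : FrobIso v₁ v₂) (he : e.DegCompatible) (x : Eˣ) : v₁ (x : E) = v₂ (x : E) := by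
  by_contra hx
  exact prop1033_2_of_ne hx ⟨e, he⟩

end Summit.ABC.IUTFork.Joshi.ATS3.Frob
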